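import Literature.AlgebraicGeometry.Resolution.HironakaDirectrixQuadratic
import Literature.AlgebraicGeometry.Resolution.HironakaDirectrixPolar
import HarnessLib

/-!
# `τ ≥ 2` of a quadratic form ⟺ two independent partial derivatives (char ≠ 2)

Topic: `Literature/AlgebraicGeometry/Resolution`.  Joins the polar LOWER bound
(`HironakaDirectrixPolar.card_le_hironakaTau_of_linearIndependent_pderiv`, every characteristic) with
the quadratic UPPER bound (`HironakaDirectrixQuadratic.hironakaTau_le_one_of_pderiv_mem_span_singleton`,
`2 ≠ 0`): for a quadratic form `F` over a field with `2 ≠ 0`,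
**`τ({F}) ≥ 2 ⟺ ∃ i j, ∂ᵢF and ∂ⱼF are linearly independent`**
(`two_le_hironakaTau_iff_exists_linearIndependent_pderiv_pair`), equivalently
`τ({F}) ≤ 1 ⟺` no two partials are independent.  This makes the hypothesis of the position-2 DROP
test of the weighted step (`WeightedCentreStepDirectrix.stepDrops_cons_cons_of_two_le_hironakaTau`:
`τ(in₂ g) ≥ 2 ⟹` DROP at position 2) a finite linear-algebra check on the gradient of the tangent
cone at every census point with `ν = 2` and `p ≠ 2` (146 of the 231 order-`a₁` points of the FE30
step census, all DROP).  The pure linear-algebra step: if no two members of a finite family are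
independent, the family lies in a line (`exists_forall_pderiv_mem_span_singleton`).
References: [CoP1] = Cossart–Piltant 2008, proof of Prop. 4.2; [CJS] = Cossart–Jannsen–Saito 2020,
Def. 2.8.  Instrument typing for the resolution observatory (pub-rosobs, carver g38); NOT summit
progress.
-/

noncomputable section

open MvPolynomial

namespace Literature.AlgebraicGeometry.Resolution

universe u

variable (k : Type u) [Field k] {d : ℕ}

/-- If no two partial derivatives of `F` are linearly independent, all of them are multiples of one
polynomial. [cite: CossartJannsenSaito2020, Def. 2.8] -/
theorem exists_forall_pderiv_mem_span_singleton (F : MvPolynomial (Fin d) k)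
    (h : ∀ i j : Fin d, ¬ LinearIndependent k ![pderiv i F, pderiv j F]) :
    ∃ P : MvPolynomial (Fin d) k, ∀ i : Fin d, pderiv i F ∈ k ∙ P := by
  by_cases h0 : ∀ i : Fin d, pderiv i F = 0
  · exact ⟨0, fun i => by rw [h0 i]; exact Submodule.zero_mem _⟩
  · obtain ⟨i₀, hi₀⟩ := not_forall.1 h0
    refine ⟨pderiv i₀ F, fun j => ?_⟩
    obtain ⟨a, ha⟩ := not_forall.1 (mt (LinearIndependent.pair_iff' hi₀).2 (h i₀ j))
    exact Submodule.mem_span_singleton.2 ⟨a, not_not.1 ha⟩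

/-- **`τ({F}) ≥ 2 ⟺ two independent partials`** for a quadratic form `F` when `2 ≠ 0`.
[cite: CossartPiltant2008, proof of Prop. 4.2], [cite: CossartJannsenSaito2020, Def. 2.8] -/
theorem two_le_hironakaTau_iff_exists_linearIndependent_pderiv_pair (h2 : (2 : k) ≠ 0)
    {F : MvPolynomial (Fin d) k} (hF : F.IsHomogeneous 2) :
    2 ≤ hironakaTau k ({F} : Set (MvPolynomial (Fin d) k)) ↔
      ∃ i j : Fin d, LinearIndependent k ![pderiv i F, pderiv j F] := by
  constructor
  · intro hτ
    by_contra hne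
    have hall : ∀ i j : Fin d, ¬ LinearIndependent k ![pderiv i F, pderiv j F] :=
      fun i j hij => hne ⟨i, j, hij⟩
    obtain ⟨P, hP⟩ := exists_forall_pderiv_mem_span_singleton k F hall
    have := hironakaTau_le_one_of_pderiv_mem_span_singleton k h2 hF P hP
    omega
  · rintro ⟨i, j, hij⟩
    have h := card_le_hironakaTau_of_linearIndependent_pderiv k F ![i, j] (ι := Fin 2) ?_
    · simpa using h
    · convert hij using 1
      funext l
      fin_cases l <;> rfl

/-- **`τ({F}) ≤ 1 ⟺ no two partials are independent`** for a quadratic form `F` when `2 ≠ 0` —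
the gradient shape of the tangent cone at a STALL point of the step census.
[cite: CossartPiltant2008, proof of Prop. 4.2], [cite: CossartJannsenSaito2020, Def. 2.8] -/
theorem hironakaTau_le_one_iff_forall_not_linearIndependent_pderiv_pair (h2 : (2 : k) ≠ 0)
    {F : MvPolynomial (Fin d) k} (hF : F.IsHomogeneous 2) :
    hironakaTau k ({F} : Set (MvPolynomial (Fin d) k)) ≤ 1 ↔
      ∀ i j : Fin d, ¬ LinearIndependent k ![pderiv i F, pderiv j F] := by
  have h := two_le_hironakaTau_iff_exists_linearIndependent_pderiv_pair k h2 hF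
  constructor
  · intro hτ i j hij
    have := h.2 ⟨i, j, hij⟩
    omega
  · intro hall
    by_contra hτ
    obtain ⟨i, j, hij⟩ := h.1 (by omega)
    exact hall i j hij

/-- Worked instance (`2 ≠ 0`): `τ(Y₀Y₁) ≥ 2` in `k[Y₀, Y₁, Y₂]` — the partials `Y₁, Y₀` are
independent. [cite: CossartJannsenSaito2020, Def. 2.8] -/
theorem two_le_hironakaTau_X_mul_X (h2 : (2 : k) ≠ 0) :
    2 ≤ hironakaTau k ({X 0 * X 1} : Set (MvPolynomial (Fin 3) k)) := by
  refine (two_le_hironakaTau_iff_exists_linearIndependent_pderiv_pair k h2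
    ((isHomogeneous_X k 0).mul (isHomogeneous_X k 1))).2 ⟨0, 1, ?_⟩
  have h0 : pderiv 0 (X 0 * X 1 : MvPolynomial (Fin 3) k) = X 1 := by
    rw [pderiv_mul, pderiv_X_self, pderiv_X_of_ne (by decide), one_mul, mul_zero, add_zero]
  have h1 : pderiv 1 (X 0 * X 1 : MvPolynomial (Fin 3) k) = X 0 := by
    rw [pderiv_mul, pderiv_X_of_ne (by decide), pderiv_X_self, zero_mul, mul_one, zero_add]
  rw [h0, h1, LinearIndependent.pair_iff' (X_ne_zero _)]
  intro a ha
  -- evaluate at the point `e₀ = (1, 0, 0)`: `a · 0 = 1`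
  have := congrArg (eval fun i : Fin 3 => if i = 0 then (1 : k) else 0) ha
  simp [MvPolynomial.smul_eval] at this

end Literature.AlgebraicGeometry.Resolution

end
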